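import Summits.Ventures.CertifiedManyBodySolver.Observables.StructureFactors

/-!
# Commensurate (stripe) momenta on every `L`-torus with `m ∣ L` (M3-L1 follow-up, seat m3-7 gen 3)

HONEST FRAMING: objects and exact identities only; no bound on any Hubbard state is claimed in
this file (first certified bounds are the programme; this is not a superconductivity verdict).

The M3 target (iii) asks for structure factors AT THE STRIPE WAVEVECTORS — period-8 charge
`Q_c = (π/4, 0) = 2π (1,0)/8` and period-16 spin `Q_s = (π − π/8, π) = 2π (7,8)/16` near `δ = 1/8` —
with the thermodynamic-limit handling explicit.  On the `L × L` torus these are admissible momenta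
exactly when `8 ∣ L` resp. `16 ∣ L` (`STRIPE-ROWS.md` §2), with momentum index `k = n • κ (mod L)`,
`L = m n`.  This file records the one fact that makes the rows UNIFORM IN `L`:

* `blochPhase_commMomentum` : for `L = m n`, `e^{2πi (nκ)·x / L} = e^{2πi κ·(x mod m) / m}` — the
  Bloch phase at a commensurate momentum depends on the site only through its reduction mod `m`
  and NOT on `L`;
* `spinStructureFactor_commMomentum`, `densityStructureFactor_commMomentum` : hence on every torus
  with `L = m n` the spin / charge structure factor at `q = 2π κ/m` is the FIXED `m`-periodic cosine
  table `r ↦ cos (2π (κ·(r mod m))/m)` applied to the real-space correlation function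
  `C(r;ψ)` (`spinStructureFactor_eq_sum_cos_mul_spinCorr`), for every state `ψ`;
* `stripeChargeIndex L n` (`m = 8`, `κ = (1,0)`), `stripeSpinIndex L n` (`m = 16`, `κ = (7,8)`):
  the two stripe momentum indices of record, so a window-truncated or full stripe row on ANY
  `8n × 8n` / `16n × 16n` torus is one `L`-independent linear functional of the per-`r` TL rows
  (`StructureFactorsAveraging`: `spinCorr_eq_re_orbitState`).
-/

namespace Summit.Ventures.CertifiedManyBodySolver.Observables

open Literature.MathematicalPhysics.QuantumLattice Literature.Probability.LatticeModels
open scoped BigOperators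

variable (L : ℕ) [NeZero L]

/-- Momentum index on the `L`-torus of the commensurate wavevector `q = 2π κ / m` when `L = m n`:
`k_i = n κ_i (mod L)` (integer numerators `κ`). -/
def commMomentum (n : ℕ) (κ : Fin 2 → ℤ) : TorusSite 2 L := fun i => (((n : ℤ) * κ i : ℤ) : ZMod L)

/-- The same numerators read as a momentum index on the `m`-torus: `κ (mod m)`. -/
def intMomentum (m : ℕ) (κ : Fin 2 → ℤ) : TorusSite 2 m := fun i => ((κ i : ℤ) : ZMod m)

/-- Reduction of a torus site mod `m`, via the canonical representative (`ZMod.val`); for `m ∣ L`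
this is the projection `ℤ/L → ℤ/m` on each coordinate. -/
def reduceSite (m : ℕ) (x : TorusSite 2 L) : TorusSite 2 m := fun i => (((x i).val : ℕ) : ZMod m)

/-- `(nκ)·x = ↑(∑ᵢ n κᵢ xᵢ.val)` in `ℤ/L`. -/
theorem torusDot_commMomentum (n : ℕ) (κ : Fin 2 → ℤ) (x : TorusSite 2 L) :
    torusDot L (commMomentum L n κ) x =
      ((∑ i : Fin 2, (n : ℤ) * κ i * ((x i).val : ℤ) : ℤ) : ZMod L) := by
  simp only [torusDot, commMomentum, Int.cast_sum, Int.cast_mul, Int.cast_natCast, ZMod.natCast_zmod_val]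

omit [NeZero L] in
/-- `κ·(x mod m) = ↑(∑ᵢ κᵢ xᵢ.val)` in `ℤ/m`. -/
theorem torusDot_intMomentum_reduceSite (m : ℕ) (κ : Fin 2 → ℤ) (x : TorusSite 2 L) :
    torusDot m (intMomentum m κ) (reduceSite L m x) =
      ((∑ i : Fin 2, κ i * ((x i).val : ℤ) : ℤ) : ZMod m) := by
  simp only [torusDot, intMomentum, reduceSite, Int.cast_sum, Int.cast_mul, Int.cast_natCast]

/-- **Commensurate momenta are `L`-independent.**  For `L = m n`:
`e^{2πi (nκ)·x / L} = e^{2πi κ·(x mod m) / m}`. -/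
theorem blochPhase_commMomentum (m n : ℕ) [NeZero m] (hL : L = m * n) (κ : Fin 2 → ℤ)
    (x : TorusSite 2 L) :
    blochPhase L (commMomentum L n κ) x = blochPhase m (intMomentum m κ) (reduceSite L m x) := by
  have hn0 : n ≠ 0 := by
    rintro rfl
    exact NeZero.ne L (by simpa using hL)
  have hn : (n : ℂ) ≠ 0 := by exact_mod_cast hn0
  have hm : (m : ℂ) ≠ 0 := by exact_mod_cast NeZero.ne m
  have hLc : (L : ℂ) = (m : ℂ) * (n : ℂ) := by exact_mod_cast hL
  rw [blochPhase, blochPhase, torusDot_commMomentum, torusDot_intMomentum_reduceSite,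
    ZMod.stdAddChar_coe, ZMod.stdAddChar_coe, hLc]
  congr 1
  push_cast
  simp only [Fin.sum_univ_two]
  rw [div_eq_div_iff (mul_ne_zero hm hn) hm]
  ring

/-- The cosine weight at a commensurate momentum is the `m`-periodic table
`cos (2π (κ·(x mod m)).val / m)`, on every `L = m n` torus. -/
theorem cos_torusDot_commMomentum (m n : ℕ) [NeZero m] (hL : L = m * n) (κ : Fin 2 → ℤ)
    (x : TorusSite 2 L) :
    Real.cos (2 * Real.pi * ((torusDot L (commMomentum L n κ) x).val : ℝ) / L) =
      Real.cos (2 * Real.pi * ((torusDot m (intMomentum m κ) (reduceSite L m x)).val : ℝ) / m) := by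
  rw [← re_blochPhase, ← re_blochPhase, blochPhase_commMomentum L m n hL]

/-- **Spin structure factor at a commensurate momentum, every `L = m n`:**
`S_s(2πκ/m; ψ) = ∑_r cos(2π κ·(r mod m)/m) · C_s(r;ψ)` — an `L`-independent cosine table. -/
theorem spinStructureFactor_commMomentum (m n : ℕ) [NeZero m] (hL : L = m * n) (κ : Fin 2 → ℤ)
    (ψ : Fock (Orb (FermionTorus 2 L))) :
    spinStructureFactor L (commMomentum L n κ) ψ =
      ∑ r : TorusSite 2 L,
        Real.cos (2 * Real.pi * ((torusDot m (intMomentum m κ) (reduceSite L m r)).val : ℝ) / m)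
          * spinCorr L r ψ := by
  rw [spinStructureFactor_eq_sum_cos_mul_spinCorr]
  refine Finset.sum_congr rfl fun r _ => ?_
  rw [cos_torusDot_commMomentum L m n hL]

/-- **Charge structure factor at a commensurate momentum, every `L = m n`** (density twin). -/
theorem densityStructureFactor_commMomentum (m n : ℕ) [NeZero m] (hL : L = m * n) (κ : Fin 2 → ℤ)
    (ψ : Fock (Orb (FermionTorus 2 L))) :
    densityStructureFactor L (commMomentum L n κ) ψ =
      ∑ r : TorusSite 2 L,
        Real.cos (2 * Real.pi * ((torusDot m (intMomentum m κ) (reduceSite L m r)).val : ℝ) / m)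
          * densityCorr L r ψ := by
  rw [densityStructureFactor_eq_sum_cos_mul_densityCorr]
  refine Finset.sum_congr rfl fun r _ => ?_
  rw [cos_torusDot_commMomentum L m n hL]

/-- The period-8 CHARGE stripe momentum index `Q_c = (π/4, 0) = 2π(1,0)/8` on the `L = 8n` torus
(`δ = 1/8`; `STRIPE-ROWS.md` §2). -/
def stripeChargeIndex (n : ℕ) : TorusSite 2 L := commMomentum L n ![1, 0]

/-- The period-16 SPIN stripe momentum index `Q_s = (π − π/8, π) = 2π(7,8)/16` on the `L = 16n` torus. -/
def stripeSpinIndex (n : ℕ) : TorusSite 2 L := commMomentum L n ![7, 8]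

/-- **Charge stripe row, uniform in `L`:** on every `8n × 8n` torus,
`S_c(Q_c; ψ) = ∑_r cos(2π (r₀ mod 8)/8) · C_c(r;ψ)`. -/
theorem densityStructureFactor_stripeCharge (n : ℕ) (hL : L = 8 * n)
    (ψ : Fock (Orb (FermionTorus 2 L))) :
    densityStructureFactor L (stripeChargeIndex L n) ψ =
      ∑ r : TorusSite 2 L,
        Real.cos (2 * Real.pi * ((torusDot 8 (intMomentum 8 ![1, 0]) (reduceSite L 8 r)).val : ℝ) / 8)
          * densityCorr L r ψ := by
  exact densityStructureFactor_commMomentum L 8 n hL ![1, 0] ψ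

/-- **Spin stripe row, uniform in `L`:** on every `16n × 16n` torus,
`S_s(Q_s; ψ) = ∑_r cos(2π (7 r₀ + 8 r₁ mod 16)/16) · C_s(r;ψ)`. -/
theorem spinStructureFactor_stripeSpin (n : ℕ) (hL : L = 16 * n)
    (ψ : Fock (Orb (FermionTorus 2 L))) :
    spinStructureFactor L (stripeSpinIndex L n) ψ =
      ∑ r : TorusSite 2 L,
        Real.cos (2 * Real.pi * ((torusDot 16 (intMomentum 16 ![7, 8]) (reduceSite L 16 r)).val : ℝ) / 16)
          * spinCorr L r ψ := by
  exact spinStructureFactor_commMomentum L 16 n hL ![7, 8] ψ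

end Summit.Ventures.CertifiedManyBodySolver.Observables
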